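import Summits.NavierStokesRegularity.NavierStokesRegularity.Theorems.SoloRefuteTsionskiy2025
import Mathlib.Analysis.SpecialFunctions.Integrals.Basic

/-!
# C15 `Tsionskiy2025` — part 3/3: (6.32)/(6.33) fail for EVERY cutoff constant `ε < 9/10`;
# the printed multiplier facts (6.8)/(6.14) hold, so the abstract inference `Step_2Abs` fails;
# the two prose rules `Rule_neglect` ((7.9), (7.11)) and `Rule_uniformMeanValue` ((6.39)) fail

Cell `ns-claims` (D-0090 NS-CLAIMS SWEEP), claim C15; refuter `ns-claims-refuter-6`; referee
`ns-claims-ref-4`. Text of record [TsionskiyTsionskiy2025]; skeleton `Literature.Claims.NS.Tsionskiy2025`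
(p462200, rev 2 p463109). The locator `Step_2` (Thm 6.1 (6.16) p. 135) is refuted in part 2
(`not_Step_2`); `Step_3` (Thm 6.2 (6.33) p. 138), `Eq632`, `Step_3Abs` are refuted in
`SoloRefuteTsionskiy2025Step3` (salvage-p6, p466643). This file adds:

* §A — `eq632_fails` / `step3_fails`: for the wide Gaussian `g(x) = e^{−(ε³/144)|x|²}`,
  `(Eg)(0) = 1 − ∫ δ(2πξ) ĝ(ξ) dξ ≥ 9/10 > ε ≥ ε‖g‖₀` for EVERY `ε ∈ (0, 9/10)` — repair census: no
  admissible choice of the cutoff constant `ε` of (3.11) rescues (6.32)/(6.33) (the printed proof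
  (6.30)–(6.31) bounds the low-frequency block by the volume `(2ε)³` of the cube times `sup|F[uᵢ]|`,
  which is not controlled by `ε‖uᵢ‖₀`).
* §B — `eq614_holds`: the printed properties (6.8)/(6.14) p. 134–135 of the multiplier of `B`
  (continuous, even, `0 ≤ A < 1`) are TRUE (`continuous_cutoff`: `δ` extends continuously by `0`,
  `0 ≤ δ(γ) ≤ |γ|²/ε³`); hence, by the skeleton's own glue `eq615_of_step2Abs` and part 2's `not_Eq615`,
  the printed inference (6.11)–(6.15) at its grain is false: `not_Step_2Abs` (class: false lemma —
  «continuous, even, `0 ≤ m < 1`» does not make `F⁻¹[m F·]` a sup-norm contraction).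
* §C — `not_Rule_neglect` («we neglect small terms … as compared with …», (7.8)→(7.9) p. 144 and
  (7.10)→(7.11) p. 145, as the rule `a ≤ b + s, 0 ≤ s ≤ cb, c ≤ 2e^{−2} ⟹ a ≤ b`: take `a = b + s`,
  `b = 1`, `s = c = 2e^{−2}`) and `not_Rule_uniformMeanValue` ((6.39) p. 139, one intermediate time
  `t*` uniform in `x`: for `G(τ, x) = τ + |x|τ²` on `[0, 1]`, `x = 0` forces `t* = 1/2` and `|x| = 1`
  forces `t* + t*² = 5/6 ≠ 3/4`). These are the LOGIC-class facts behind Steps 7/9 and Step 4; the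
  locator of the row stays `Step_2` (part 2).

Closed terms; axioms `propext`, `Classical.choice`, `Quot.sound`.

WHAT THIS IS NOT: not a claim about NS regularity or blow-up; not a claim about any author beyond the
typed locator.
-/

-- The summit's canonical theorem namespace repeats the summit name (single-conjunct summit).
set_option linter.dupNamespace false

noncomputable section

open MeasureTheory Real Filter Topology Set
open scoped RealInnerProductSpace FourierTransform ContDiff SchwartzMap
open Literature.Claims.NS.Tsionskiy2025

namespace Summit.NavierStokesRegularity.NavierStokesRegularity.Theorems.Tsionskiy2025

/-! ## §A — `E` on the wide Gaussian: (6.32)/(6.33) fail for every `ε < 9/10` -/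

/-- `E` on a scalar, sign-free form (= `opE`, see `opE_eq`). -/
def Eop (ε : ℝ) (u : E3 → ℝ) : E3 → ℝ := mulOpEv (symbE ε) u

/-- Value at `0` of the multiplier operator on a Gaussian: a Gaussian average of the symbol. -/
lemma mulOp_gfun_zero {a : ℝ} (ha : 0 < a) (m : E3 → ℝ) :
    mulOpEv m (gfun a) 0 = ∫ ξ : E3, m ((2 * π) • ξ) * ghat a ξ := by
  unfold mulOpEv
  have h1 : (fun ξ : E3 => ((m ((2 * π) • ξ) : ℝ) : ℂ) * 𝓕 (fun y : E3 => ((gfun a y : ℝ) : ℂ)) ξ)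
      = fun ξ => (((m ((2 * π) • ξ) * ghat a ξ : ℝ)) : ℂ) := by
    funext ξ; rw [fourier_gfun ha]; push_cast; ring
  rw [h1, fourierInv_apply_zero, integral_complex_ofReal, Complex.ofReal_re]

/-- `(E g)(0) ≥ 9/10` for `g = e^{-(ε³/144)‖·‖²}`. -/
lemma Eop_gfun_zero_ge {ε : ℝ} (hε : 0 < ε) : 9 / 10 ≤ Eop ε (gfun (ε ^ 3 / 144)) 0 := by
  have ha : 0 < ε ^ 3 / 144 := by positivity
  rw [Eop, mulOp_gfun_zero ha]
  simp only [symbE]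
  have hI := integrable_cutoff_smul_mul_ghat hε.le ha
  have hsplit : (fun ξ : E3 => (1 - cutoff ε ((2 * π) • ξ)) * ghat (ε ^ 3 / 144) ξ)
      = fun ξ => ghat (ε ^ 3 / 144) ξ - cutoff ε ((2 * π) • ξ) * ghat (ε ^ 3 / 144) ξ := by
    funext ξ; ring
  rw [hsplit, integral_sub (integrable_ghat ha) hI, integral_ghat ha]
  linarith [avg_cutoff_wide_le hε]

/-- `|e^{-a‖y‖²}| ≤ 1` for `a ≥ 0`. -/
lemma abs_gfun_le_one {a : ℝ} (ha : 0 ≤ a) (y : E3) : |gfun a y| ≤ 1 := by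
  rw [gfun, abs_of_pos (Real.exp_pos _), Real.exp_le_one_iff]
  nlinarith [norm_nonneg y]

/-- `g(0) = 1`. -/
lemma gfun_zero (a : ℝ) : gfun a 0 = 1 := by simp [gfun]

/-- The multiplier `1 - δ` of `E` is even ((6.22) p. 136). -/
lemma symbE_even (ε : ℝ) (γ : E3) : symbE ε (-γ) = symbE ε γ := by
  simp [symbE, cutoff, norm_neg, neg_eq_zero]

/-- The skeleton's `opE` (6.18)/(6.20)–(6.21) pp. 135–136 is `Eop` (even multiplier).
[cite: TsionskiyTsionskiy2025, (6.20)–(6.22) p. 136] -/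
lemma opE_eq (ε : ℝ) (φ : E3 → ℝ) : opE ε φ = Eop ε φ := by
  funext x
  rw [opE, mulOp_eq_of_even (symbE_even ε)]
  rfl

/-- `e^{-a‖·‖²}` is (the coercion of) the Schwartz map `realGaussianSchwartz E3 a` (`a > 0`). -/
lemma gfun_eq_coe {a : ℝ} (ha : 0 < a) :
    gfun a = ⇑(Literature.Analysis.FunctionSpaces.realGaussianSchwartz E3 a) := by
  rw [Literature.Analysis.FunctionSpaces.coe_realGaussianSchwartz ha]; rfl

/-- The Gaussian `e^{-a|x|²}`, `a > 0`, is in the paper's class `S`. -/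
lemma inS_gfun {a : ℝ} (ha : 0 < a) : InS (gfun a) := by
  rw [gfun_eq_coe ha]; exact inS_schwartz _

/-- **(6.32) fails**: for every `ε ∈ (0, 9/10)` the Gaussian `g = e^{−(ε³/144)|x|²}` has
`ε‖g‖₀ ≤ ε < 9/10 ≤ (Eg)(0) ≤ ‖Eg‖₀`. [cite: TsionskiyTsionskiy2025, Thm 6.2 (6.32) p.138] -/
theorem eq632_fails {ε : ℝ} (hε : 0 < ε) (hε' : ε < 9 / 10) :
    ε * supNorm (gfun (ε ^ 3 / 144)) < supNorm (opE ε (gfun (ε ^ 3 / 144))) := by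
  have h1 : supNorm (gfun (ε ^ 3 / 144)) ≤ 1 := supNorm_le (abs_gfun_le_one (by positivity))
  have h1' : ε * supNorm (gfun (ε ^ 3 / 144)) ≤ ε := mul_le_of_le_one_right hε.le h1
  have h2 : 9 / 10 ≤ opE ε (gfun (ε ^ 3 / 144)) 0 := by
    rw [opE_eq]; exact Eop_gfun_zero_ge hε
  have h3 : |opE ε (gfun (ε ^ 3 / 144)) 0| ≤ supNorm (opE ε (gfun (ε ^ 3 / 144))) := by
    rw [opE_eq]; exact abs_mulOp_le_supNorm _ _ 0
  have h4 := le_abs_self (opE ε (gfun (ε ^ 3 / 144)) 0)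
  linarith

/-- The vector instance `u⃗ = (g, g, g)` of (6.33). [cite: TsionskiyTsionskiy2025, Thm 6.2 (6.33) p.138] -/
theorem step3_fails {ε : ℝ} (hε : 0 < ε) (hε' : ε < 9 / 10) :
    ¬ vecNorm (fun i => opE ε ((fun _ : Fin 3 => gfun (ε ^ 3 / 144)) i))
        < ε * vecNorm (fun _ : Fin 3 => gfun (ε ^ 3 / 144)) := by
  intro hlt
  have := eq632_fails hε hε'
  simp only [vecNorm_const] at hlt
  nlinarith

/-! ## §B — the printed multiplier facts (6.8)/(6.14) hold; `Step_2Abs` fails -/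

/-- `δ(γ) < 1` for `ε > 0`. -/
lemma cutoff_lt_one {ε : ℝ} (hε : 0 < ε) (γ : E3) : cutoff ε γ < 1 := by
  unfold cutoff; split_ifs with h
  · exact zero_lt_one
  · have hγ : 0 < ‖γ‖ := norm_pos_iff.mpr h
    rw [Real.exp_lt_one_iff]
    exact div_neg_of_neg_of_pos (neg_neg_of_pos (pow_pos hε 3)) (pow_pos hγ 2)

/-- `δ(γ) ≤ |γ|²/ε³` (`e^{−y} ≤ 1/y`): the cutoff vanishes to second order at `γ = 0`. -/
lemma cutoff_le_norm_sq_div {ε : ℝ} (hε : 0 < ε) (γ : E3) : cutoff ε γ ≤ ‖γ‖ ^ 2 / ε ^ 3 := by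
  unfold cutoff; split_ifs with h
  · positivity
  · have hγ : 0 < ‖γ‖ := norm_pos_iff.mpr h
    have hy : 0 < ε ^ 3 / ‖γ‖ ^ 2 := by positivity
    have h1 : ε ^ 3 / ‖γ‖ ^ 2 + 1 ≤ Real.exp (ε ^ 3 / ‖γ‖ ^ 2) := Real.add_one_le_exp _
    rw [show -(ε ^ 3) / ‖γ‖ ^ 2 = -(ε ^ 3 / ‖γ‖ ^ 2) by ring, Real.exp_neg]
    calc (Real.exp (ε ^ 3 / ‖γ‖ ^ 2))⁻¹ ≤ (ε ^ 3 / ‖γ‖ ^ 2)⁻¹ :=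
          inv_anti₀ hy (by linarith)
      _ = ‖γ‖ ^ 2 / ε ^ 3 := by rw [inv_div]

/-- **`δ` is continuous** (extended by `0` at `γ = 0`), `ε > 0`. -/
lemma continuous_cutoff {ε : ℝ} (hε : 0 < ε) : Continuous (cutoff ε) := by
  refine continuous_iff_continuousAt.mpr fun γ₀ => ?_
  by_cases h0 : γ₀ = 0
  · subst h0
    have hval : cutoff ε (0 : E3) = 0 := by simp [cutoff]
    have hup : Tendsto (fun γ : E3 => ‖γ‖ ^ 2 / ε ^ 3) (𝓝 0) (𝓝 0) := by
      simpa using (((continuous_norm (E := E3)).pow 2).div_const (ε ^ 3)).tendsto (0 : E3)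
    have h : Tendsto (cutoff ε) (𝓝 (0 : E3)) (𝓝 0) :=
      tendsto_of_tendsto_of_tendsto_of_le_of_le tendsto_const_nhds hup
        (fun γ => cutoff_nonneg ε γ) (fun γ => cutoff_le_norm_sq_div hε γ)
    rw [ContinuousAt, hval]; exact h
  · have hne : ‖γ₀‖ ^ 2 ≠ 0 := pow_ne_zero 2 (norm_ne_zero_iff.mpr h0)
    have hc : ContinuousAt (fun γ : E3 => Real.exp (-(ε ^ 3) / ‖γ‖ ^ 2)) γ₀ :=
      (continuousAt_const.div (((continuous_norm (E := E3)).pow 2).continuousAt) hne).rexp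
    refine hc.congr ?_
    filter_upwards [isOpen_ne.mem_nhds h0] with γ hγ
    simp only [cutoff, if_neg hγ]

/-- **`Eq614` holds**: the multiplier of `B` is continuous, even, and takes values in `[0, 1)`
((6.8) p. 134, (6.14) p. 135). [cite: TsionskiyTsionskiy2025, (6.8) p.134, (6.14) p.135] -/
theorem eq614_holds : Eq614 := by
  intro ν hν ε hε _ t ht _
  refine ⟨?_, fun γ => ?_, fun γ => ⟨?_, ?_⟩⟩
  · rw [symbB_eq_multB]
    unfold multB
    exact ((continuous_const.mul ((continuous_norm (E := E3)).pow 2)).rexp).mul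
      (continuous_cutoff hε)
  · rw [symbB_eq_multB]; exact multB_even ν t ε γ
  · rw [symbB_eq_multB]; exact multB_nonneg ν t ε γ
  · rw [symbB_eq_multB]
    exact (multB_le_cutoff (mul_nonneg hν ht.le) γ).trans_lt (cutoff_lt_one hε γ)

/-- **`¬ Step_2Abs`** — the printed inference (6.11)–(6.15) p. 134–135 at its grain («for a continuous,
even multiplier `m` with `0 ≤ m < 1`, `‖F⁻¹[m F φ]‖₀ < ‖φ‖₀` for every nonzero `φ ∈ S`») is false: the
multiplier of `B` itself meets (6.8)/(6.14) (`eq614_holds`) and violates the conclusion (`not_Eq615`,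
part 2), via the skeleton's glue `eq615_of_step2Abs`. Class: false lemma (countermodel).
[cite: TsionskiyTsionskiy2025, (6.11)–(6.15) pp.134–135] -/
theorem not_Step_2Abs : ¬ Step_2Abs := fun h => not_Eq615 (eq615_of_step2Abs eq614_holds h)

/-! ## §C — the prose rules behind Steps 7/9 and Step 4 -/

/-- **`¬ Rule_neglect`** — «we neglect small terms … as compared with …» ((7.8)→(7.9) p. 144,
(7.10)→(7.11) p. 145) as a rule about reals is false: `a = b + s`, `b = 1`, `s = c = 2e^{−2} > 0`
satisfy `a ≤ b + s`, `0 ≤ s ≤ cb`, `c ≤ 2e^{−2}`, and `a > b`. (LOGIC class of those passages; the row's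
locator is `Step_2`.) [cite: TsionskiyTsionskiy2025, (7.9) p.144, (7.11) p.145] -/
theorem not_Rule_neglect : ¬ Rule_neglect := by
  intro h
  have hc : (0:ℝ) < 2 * Real.exp (-2) := by positivity
  have := h (1 + 2 * Real.exp (-2)) 1 (2 * Real.exp (-2)) (2 * Real.exp (-2)) zero_le_one hc.le
    le_rfl hc.le (by rw [mul_one]) le_rfl
  linarith

/-- **`¬ Rule_uniformMeanValue`** — (6.39) p. 139 uses ONE intermediate time `t*` for all `x`; for the
jointly continuous `G(τ, x) = τ + |x|τ²` on `[0, 1]`: at `x = 0`, `∫₀¹ τ dτ = 1/2 = t*`; at `|x| = 1`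
(the first basis vector),
`∫₀¹ (τ + τ²) dτ = 5/6 = t* + t*² = 3/4` — impossible. (LOGIC class of Step 4; the row's locator is
`Step_2`.) [cite: TsionskiyTsionskiy2025, (6.39) p.139] -/
theorem not_Rule_uniformMeanValue : ¬ Rule_uniformMeanValue := by
  intro h
  have hcont : ContinuousOn (Function.uncurry fun (τ : ℝ) (x : E3) => τ + ‖x‖ * τ ^ 2)
      (Icc 0 1 ×ˢ univ) :=
    (continuous_fst.add ((continuous_norm.comp continuous_snd).mul (continuous_fst.pow 2))).continuousOn
  obtain ⟨ts, _, _, hall⟩ := h 1 one_pos (fun τ x => τ + ‖x‖ * τ ^ 2) hcont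
  have key : ∀ c : ℝ, ∫ τ in (0:ℝ)..1, (τ + c * τ ^ 2) = 1 / 2 + c / 3 := by
    intro c
    have hi1 : IntervalIntegrable (fun τ : ℝ => τ) volume 0 1 := continuous_id.intervalIntegrable 0 1
    have hi2 : IntervalIntegrable (fun τ : ℝ => c * τ ^ 2) volume 0 1 :=
      (continuous_const.mul (continuous_pow 2)).intervalIntegrable 0 1
    rw [intervalIntegral.integral_add hi1 hi2, intervalIntegral.integral_const_mul, integral_id,
      integral_pow]
    norm_num; ring
  have hunit : ‖(EuclideanSpace.basisFun (Fin 3) ℝ) 0‖ = 1 :=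
    (EuclideanSpace.basisFun (Fin 3) ℝ).orthonormal.1 0
  have h0 := hall 0
  have h1 := hall ((EuclideanSpace.basisFun (Fin 3) ℝ) 0)
  rw [key] at h0 h1
  rw [norm_zero] at h0
  rw [hunit] at h1
  have hts : ts = 1 / 2 := by linarith
  rw [hts] at h1
  norm_num at h1

end Summit.NavierStokesRegularity.NavierStokesRegularity.Theorems.Tsionskiy2025
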